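import Literature.MathematicalPhysics.QuantumManyBody.DiluteBoseGasLHYRiemannSum
import HarnessLib

/-!
# Power sums over shells of `ℤ³`

Topic `Literature/MathematicalPhysics/QuantumManyBody`, namespace `BoseGas`; theorem-only (the lattice
sums of §5 of [BastiCenatiempoSchlein2021] — "`‖σ_L‖² ≤ CN^{3κ/2}`, `‖η_H‖² ≤ CN^{3κ-1+ε}`,
`‖σ_Lγ_L‖₁ ≤ CN^{3κ/2-ε}`, …" — all reduce to `∑_{|n|∞ ∈ [a,b]} |n|∞^{-s}` on `ℤ³`), for the provefact
`Literature.MathematicalPhysics.QuantumManyBody.BoseGas.BastiCenatiempoSchlein2021_upperBound`.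

* `sum_shell_le` / `sum_shell_le_int` — the generic shell bound
  `∑_{k : a ≤ |k|∞ ≤ b} f(|k|∞) ≤ (8·)∑_{j=a}^{b} 3(j+1)² f(j)` on `ℕ₀³` / `ℤ³` (`f ≥ 0`);
* the one-dimensional sums `∑_{j=1}^{R} 3(j+1)²j^{-2} ≤ 12R`, `∑ 3(j+1)²j^{-1} ≤ 12R²`,
  `∑ 3(j+1)²·j ≤ 12R⁴`, `∑_{j=0}^{R} 3(j+1)² ≤ 3(R+1)³`, `∑_{j≥N} 3(j+1)²j^{-4} ≤ 24/N`,
  `∑_{j≥N} 3(j+1)²j^{-6} ≤ 24/N³`;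
* the resulting bounds on `ℤ³` (`sum_inv_supNorm_sq_le`, `sum_inv_supNorm_le`, `sum_supNorm_le`,
  `card_supNorm_le`, `sum_inv_supNorm_pow_four_le`, `sum_inv_supNorm_pow_six_le`) and the comparison
  `|n|∞² ≤ ∑ⱼnⱼ² ≤ 3|n|∞²` (`supNorm_sq_le_nsq`, `nsq_le_three_supNorm_sq`).

## References

* [BastiCenatiempoSchlein2021] G. Basti, S. Cenatiempo, B. Schlein, Forum Math. Sigma 9 (2021) e74,
  arXiv:2101.06222: §2 (bounds after (2.8)), §5.
-/

noncomputable section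

open Finset
open scoped BigOperators

namespace Literature.MathematicalPhysics.QuantumManyBody.BoseGas

/-! ### The generic shell bound -/

/-- **Shell bound on `ℕ₀³`**: `∑_{k ∈ u, a ≤ |k|∞ ≤ b} f(|k|∞) ≤ ∑_{j=a}^{b} 3(j+1)²f(j)` for `f ≥ 0`.
[folklore] -/
theorem sum_shell_le (u : Finset (Fin 3 → ℕ)) {f : ℕ → ℝ} (hf : ∀ j, 0 ≤ f j) (a b : ℕ) :
    ∑ k ∈ u.filter (fun k => a ≤ univ.sup k ∧ univ.sup k ≤ b), f (univ.sup k) ≤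
      ∑ j ∈ Icc a b, 3 * ((j : ℝ) + 1) ^ 2 * f j := by
  set T := u.filter (fun k => a ≤ univ.sup k ∧ univ.sup k ≤ b) with hT
  have hmaps : ∀ k ∈ T, univ.sup k ∈ Icc a b := fun k hk => by
    have h := (mem_filter.1 hk).2
    exact mem_Icc.2 ⟨h.1, h.2⟩
  rw [← sum_fiberwise_of_maps_to hmaps]
  refine sum_le_sum fun j _ => ?_
  calc ∑ k ∈ T.filter (fun k => univ.sup k = j), f (univ.sup k)
      = ∑ k ∈ T.filter (fun k => univ.sup k = j), f j := sum_congr rfl fun k hk => by rw [(mem_filter.1 hk).2]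
    _ = ((T.filter fun k => univ.sup k = j).card : ℝ) * f j := by rw [sum_const, nsmul_eq_mul]
    _ ≤ 3 * ((j : ℝ) + 1) ^ 2 * f j := mul_le_mul_of_nonneg_right (card_filter_sup_eq_le j T) (hf j)

/-- **Shell bound on `ℤ³`**: `∑_{n ∈ U, a ≤ |n|∞ ≤ b} f(|n|∞) ≤ 8∑_{j=a}^{b} 3(j+1)²f(j)` for `f ≥ 0`.
[folklore] -/
theorem sum_shell_le_int (U : Finset (Fin 3 → ℤ)) {f : ℕ → ℝ} (hf : ∀ j, 0 ≤ f j) (a b : ℕ) :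
    ∑ n ∈ U.filter (fun n => a ≤ (univ.sup fun j => (n j).natAbs) ∧ (univ.sup fun j => (n j).natAbs) ≤ b),
        f (univ.sup fun j => (n j).natAbs) ≤
      8 * ∑ j ∈ Icc a b, 3 * ((j : ℝ) + 1) ^ 2 * f j := by
  set U' := U.filter (fun n => a ≤ (univ.sup fun j => (n j).natAbs) ∧ (univ.sup fun j => (n j).natAbs) ≤ b)
    with hU'
  set φ : (Fin 3 → ℤ) → (Fin 3 → ℕ) := fun n j => (n j).natAbs with hφ
  set g : (Fin 3 → ℕ) → ℝ := fun k => f (univ.sup k) with hg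
  have h2 := sum_le_eight_mul_sum_image (U := U') (g := g) (fun k => hf _)
  have h3 : ∑ k ∈ U'.image φ, g k ≤ ∑ j ∈ Icc a b, 3 * ((j : ℝ) + 1) ^ 2 * f j := by
    have hfilt : (U'.image φ).filter (fun k => a ≤ univ.sup k ∧ univ.sup k ≤ b) = U'.image φ := by
      apply Finset.filter_true_of_mem
      intro k hk
      rw [Finset.mem_image] at hk
      obtain ⟨n, hn, rfl⟩ := hk
      exact (Finset.mem_filter.1 hn).2
    have := sum_shell_le (U'.image φ) hf a b
    rwa [hfilt] at this
  calc ∑ n ∈ U', f (univ.sup fun j => (n j).natAbs) = ∑ n ∈ U', g (φ n) := rfl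
    _ ≤ 8 * ∑ k ∈ U'.image φ, g k := h2
    _ ≤ _ := by gcongr

/-! ### One-dimensional sums -/

/-- `3(j+1)² ≤ 12j²` for `j ≥ 1`. [folklore] -/
theorem three_mul_succ_sq_le {j : ℕ} (hj : 1 ≤ j) : 3 * ((j : ℝ) + 1) ^ 2 ≤ 12 * (j : ℝ) ^ 2 := by
  have hj1 : (1 : ℝ) ≤ j := by exact_mod_cast hj
  nlinarith

/-- `∑_{j=1}^{R} 3(j+1)²/j² ≤ 12R`. [folklore] -/
theorem sum_Icc_shell_inv_sq_le (R : ℕ) :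
    ∑ j ∈ Icc 1 R, 3 * ((j : ℝ) + 1) ^ 2 * ((j : ℝ) ^ 2)⁻¹ ≤ 12 * (R : ℝ) := by
  calc ∑ j ∈ Icc 1 R, 3 * ((j : ℝ) + 1) ^ 2 * ((j : ℝ) ^ 2)⁻¹ ≤ ∑ j ∈ Icc 1 R, (12 : ℝ) := by
        refine sum_le_sum fun j hj => ?_
        have hj1 := (mem_Icc.1 hj).1
        have hj0 : (0 : ℝ) < j := by exact_mod_cast hj1
        calc 3 * ((j : ℝ) + 1) ^ 2 * ((j : ℝ) ^ 2)⁻¹ ≤ 12 * (j : ℝ) ^ 2 * ((j : ℝ) ^ 2)⁻¹ :=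
              mul_le_mul_of_nonneg_right (three_mul_succ_sq_le hj1) (by positivity)
          _ = 12 := by field_simp
    _ = 12 * (R : ℝ) := by simp [mul_comm]

/-- `∑_{j=1}^{R} 3(j+1)²/j ≤ 12R²`. [folklore] -/
theorem sum_Icc_shell_inv_le (R : ℕ) :
    ∑ j ∈ Icc 1 R, 3 * ((j : ℝ) + 1) ^ 2 * ((j : ℝ))⁻¹ ≤ 12 * (R : ℝ) ^ 2 := by
  calc ∑ j ∈ Icc 1 R, 3 * ((j : ℝ) + 1) ^ 2 * ((j : ℝ))⁻¹ ≤ ∑ j ∈ Icc 1 R, (12 * R : ℝ) := by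
        refine sum_le_sum fun j hj => ?_
        have hj1 := (mem_Icc.1 hj).1
        have hjR : (j : ℝ) ≤ R := by exact_mod_cast (mem_Icc.1 hj).2
        have hj0 : (0 : ℝ) < j := by exact_mod_cast hj1
        calc 3 * ((j : ℝ) + 1) ^ 2 * ((j : ℝ))⁻¹ ≤ 12 * (j : ℝ) ^ 2 * ((j : ℝ))⁻¹ :=
              mul_le_mul_of_nonneg_right (three_mul_succ_sq_le hj1) (by positivity)
          _ = 12 * j := by field_simp
          _ ≤ 12 * R := by linarith
    _ = 12 * (R : ℝ) ^ 2 := by simp; ring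

/-- `∑_{j=1}^{R} 3(j+1)²·j ≤ 12R⁴`. [folklore] -/
theorem sum_Icc_shell_mul_le (R : ℕ) :
    ∑ j ∈ Icc 1 R, 3 * ((j : ℝ) + 1) ^ 2 * (j : ℝ) ≤ 12 * (R : ℝ) ^ 4 := by
  calc ∑ j ∈ Icc 1 R, 3 * ((j : ℝ) + 1) ^ 2 * (j : ℝ) ≤ ∑ j ∈ Icc 1 R, (12 * (R : ℝ) ^ 3) := by
        refine sum_le_sum fun j hj => ?_
        have hj1 := (mem_Icc.1 hj).1
        have hjR : (j : ℝ) ≤ R := by exact_mod_cast (mem_Icc.1 hj).2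
        have hj0 : (0 : ℝ) ≤ j := Nat.cast_nonneg j
        calc 3 * ((j : ℝ) + 1) ^ 2 * (j : ℝ) ≤ 12 * (j : ℝ) ^ 2 * j :=
              mul_le_mul_of_nonneg_right (three_mul_succ_sq_le hj1) hj0
          _ = 12 * (j : ℝ) ^ 3 := by ring
          _ ≤ 12 * (R : ℝ) ^ 3 := by gcongr
    _ = 12 * (R : ℝ) ^ 4 := by simp; ring

/-- `∑_{j=0}^{R} 3(j+1)² ≤ 3(R+1)³`. [folklore] -/
theorem sum_Icc_shell_le (R : ℕ) :
    ∑ j ∈ Icc 0 R, 3 * ((j : ℝ) + 1) ^ 2 ≤ 3 * ((R : ℝ) + 1) ^ 3 := by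
  calc ∑ j ∈ Icc 0 R, 3 * ((j : ℝ) + 1) ^ 2 ≤ ∑ j ∈ Icc 0 R, 3 * ((R : ℝ) + 1) ^ 2 := by
        refine sum_le_sum fun j hj => ?_
        have hjR : (j : ℝ) ≤ R := by exact_mod_cast (mem_Icc.1 hj).2
        have hj0 : (0 : ℝ) ≤ j := Nat.cast_nonneg j
        gcongr
    _ = 3 * ((R : ℝ) + 1) ^ 3 := by simp; ring

/-- `∑_{j=N}^{M} 3(j+1)²/j⁴ ≤ 24/N` (`N ≥ 1`). [folklore] -/
theorem sum_Icc_shell_inv_pow_four_le {N : ℕ} (hN : 1 ≤ N) (M : ℕ) :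
    ∑ j ∈ Icc N M, 3 * ((j : ℝ) + 1) ^ 2 * ((j : ℝ) ^ 4)⁻¹ ≤ 24 / (N : ℝ) := by
  calc ∑ j ∈ Icc N M, 3 * ((j : ℝ) + 1) ^ 2 * ((j : ℝ) ^ 4)⁻¹ ≤ ∑ j ∈ Icc N M, 12 * ((j : ℝ) ^ 2)⁻¹ := by
        refine sum_le_sum fun j hj => ?_
        have hj1 : 1 ≤ j := hN.trans (mem_Icc.1 hj).1
        have hj0 : (0 : ℝ) < j := by exact_mod_cast hj1
        calc 3 * ((j : ℝ) + 1) ^ 2 * ((j : ℝ) ^ 4)⁻¹ ≤ 12 * (j : ℝ) ^ 2 * ((j : ℝ) ^ 4)⁻¹ :=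
              mul_le_mul_of_nonneg_right (three_mul_succ_sq_le hj1) (by positivity)
          _ = 12 * ((j : ℝ) ^ 2)⁻¹ := by field_simp
    _ = 12 * ∑ j ∈ Icc N M, ((j : ℝ) ^ 2)⁻¹ := by rw [mul_sum]
    _ ≤ 12 * (2 / N) := by gcongr; exact sum_Icc_inv_sq_le hN M
    _ = 24 / (N : ℝ) := by ring

/-- `∑_{j=N}^{M} 3(j+1)²/j⁶ ≤ 24/N³` (`N ≥ 1`). [folklore] -/
theorem sum_Icc_shell_inv_pow_six_le {N : ℕ} (hN : 1 ≤ N) (M : ℕ) :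
    ∑ j ∈ Icc N M, 3 * ((j : ℝ) + 1) ^ 2 * ((j : ℝ) ^ 6)⁻¹ ≤ 24 / (N : ℝ) ^ 3 := by
  have hN0 : (0 : ℝ) < N := by exact_mod_cast hN
  calc ∑ j ∈ Icc N M, 3 * ((j : ℝ) + 1) ^ 2 * ((j : ℝ) ^ 6)⁻¹
      ≤ ∑ j ∈ Icc N M, 12 / (N : ℝ) ^ 2 * ((j : ℝ) ^ 2)⁻¹ := by
        refine sum_le_sum fun j hj => ?_
        have hjN : (N : ℝ) ≤ j := by exact_mod_cast (mem_Icc.1 hj).1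
        have hj1 : 1 ≤ j := hN.trans (mem_Icc.1 hj).1
        have hj0 : (0 : ℝ) < j := by exact_mod_cast hj1
        calc 3 * ((j : ℝ) + 1) ^ 2 * ((j : ℝ) ^ 6)⁻¹ ≤ 12 * (j : ℝ) ^ 2 * ((j : ℝ) ^ 6)⁻¹ :=
              mul_le_mul_of_nonneg_right (three_mul_succ_sq_le hj1) (by positivity)
          _ = 12 / (j : ℝ) ^ 2 * ((j : ℝ) ^ 2)⁻¹ := by field_simp
          _ ≤ 12 / (N : ℝ) ^ 2 * ((j : ℝ) ^ 2)⁻¹ := by gcongr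
    _ = 12 / (N : ℝ) ^ 2 * ∑ j ∈ Icc N M, ((j : ℝ) ^ 2)⁻¹ := by rw [mul_sum]
    _ ≤ 12 / (N : ℝ) ^ 2 * (2 / N) := by gcongr; exact sum_Icc_inv_sq_le hN M
    _ = 24 / (N : ℝ) ^ 3 := by field_simp; ring

/-! ### The bounds on `ℤ³` -/

section IntLattice

/-- **`∑_{1 ≤ |n|∞ ≤ R} |n|∞⁻² ≤ 96R`.** [folklore] -/
theorem sum_inv_supNorm_sq_le (U : Finset (Fin 3 → ℤ)) (R : ℕ) :
    ∑ n ∈ U.filter (fun n => 1 ≤ (univ.sup fun j => (n j).natAbs) ∧ (univ.sup fun j => (n j).natAbs) ≤ R), ((((univ.sup fun j => (n j).natAbs : ℕ)) : ℝ) ^ 2)⁻¹ ≤ 96 * (R : ℝ) := by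
  have h := sum_shell_le_int U (f := fun j => ((j : ℝ) ^ 2)⁻¹) (fun j => by positivity) 1 R
  exact h.trans (by linarith [sum_Icc_shell_inv_sq_le R])

/-- **`∑_{1 ≤ |n|∞ ≤ R} |n|∞⁻¹ ≤ 96R²`.** [folklore] -/
theorem sum_inv_supNorm_le (U : Finset (Fin 3 → ℤ)) (R : ℕ) :
    ∑ n ∈ U.filter (fun n => 1 ≤ (univ.sup fun j => (n j).natAbs) ∧ (univ.sup fun j => (n j).natAbs) ≤ R), ((((univ.sup fun j => (n j).natAbs : ℕ)) : ℝ))⁻¹ ≤ 96 * (R : ℝ) ^ 2 := by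
  have h := sum_shell_le_int U (f := fun j => ((j : ℝ))⁻¹) (fun j => by positivity) 1 R
  exact h.trans (by linarith [sum_Icc_shell_inv_le R])

/-- **`∑_{1 ≤ |n|∞ ≤ R} |n|∞ ≤ 96R⁴`.** [folklore] -/
theorem sum_supNorm_le (U : Finset (Fin 3 → ℤ)) (R : ℕ) :
    ∑ n ∈ U.filter (fun n => 1 ≤ (univ.sup fun j => (n j).natAbs) ∧ (univ.sup fun j => (n j).natAbs) ≤ R), (((univ.sup fun j => (n j).natAbs : ℕ)) : ℝ) ≤ 96 * (R : ℝ) ^ 4 := by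
  have h := sum_shell_le_int U (f := fun j => (j : ℝ)) (fun j => Nat.cast_nonneg j) 1 R
  exact h.trans (by linarith [sum_Icc_shell_mul_le R])

/-- **`#{n : |n|∞ ≤ R} ≤ 24(R+1)³`.** [folklore] -/
theorem card_supNorm_le (U : Finset (Fin 3 → ℤ)) (R : ℕ) :
    ((U.filter (fun n => (univ.sup fun j => (n j).natAbs) ≤ R)).card : ℝ) ≤ 24 * ((R : ℝ) + 1) ^ 3 := by
  have h := sum_shell_le_int U (f := fun _ => (1 : ℝ)) (fun j => zero_le_one) 0 R
  have hset : U.filter (fun n => 0 ≤ (univ.sup fun j => (n j).natAbs) ∧ (univ.sup fun j => (n j).natAbs) ≤ R) = U.filter (fun n => (univ.sup fun j => (n j).natAbs) ≤ R) :=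
    Finset.filter_congr fun n _ => by simp
  rw [hset] at h
  simp only [sum_const, nsmul_eq_mul, mul_one] at h
  exact h.trans (by linarith [sum_Icc_shell_le R])

/-- **`∑_{|n|∞ ≥ N} |n|∞⁻⁴ ≤ 192/N`** (`N ≥ 1`). [folklore] -/
theorem sum_inv_supNorm_pow_four_le (U : Finset (Fin 3 → ℤ)) {N : ℕ} (hN : 1 ≤ N) :
    ∑ n ∈ U.filter (fun n => N ≤ (univ.sup fun j => (n j).natAbs)), ((((univ.sup fun j => (n j).natAbs : ℕ)) : ℝ) ^ 4)⁻¹ ≤ 192 / (N : ℝ) := by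
  set M := U.sup (fun n => univ.sup fun j => (n j).natAbs) with hM
  have hset : U.filter (fun n => N ≤ (univ.sup fun j => (n j).natAbs)) = U.filter (fun n => N ≤ (univ.sup fun j => (n j).natAbs) ∧ (univ.sup fun j => (n j).natAbs) ≤ M) :=
    Finset.filter_congr fun n hn => by
      constructor
      · intro h; exact ⟨h, Finset.le_sup (f := fun n => univ.sup fun j => (n j).natAbs) hn⟩
      · intro h; exact h.1
  rw [hset]
  have h := sum_shell_le_int U (f := fun j => ((j : ℝ) ^ 4)⁻¹) (fun j => by positivity) N M
  have h1 := sum_Icc_shell_inv_pow_four_le hN M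
  calc _ ≤ _ := h
    _ ≤ 8 * (24 / (N : ℝ)) := by gcongr
    _ = 192 / (N : ℝ) := by ring

/-- **`∑_{|n|∞ ≥ N} |n|∞⁻⁶ ≤ 192/N³`** (`N ≥ 1`). [folklore] -/
theorem sum_inv_supNorm_pow_six_le (U : Finset (Fin 3 → ℤ)) {N : ℕ} (hN : 1 ≤ N) :
    ∑ n ∈ U.filter (fun n => N ≤ (univ.sup fun j => (n j).natAbs)), ((((univ.sup fun j => (n j).natAbs : ℕ)) : ℝ) ^ 6)⁻¹ ≤ 192 / (N : ℝ) ^ 3 := by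
  set M := U.sup (fun n => univ.sup fun j => (n j).natAbs) with hM
  have hset : U.filter (fun n => N ≤ (univ.sup fun j => (n j).natAbs)) = U.filter (fun n => N ≤ (univ.sup fun j => (n j).natAbs) ∧ (univ.sup fun j => (n j).natAbs) ≤ M) :=
    Finset.filter_congr fun n hn => by
      constructor
      · intro h; exact ⟨h, Finset.le_sup (f := fun n => univ.sup fun j => (n j).natAbs) hn⟩
      · intro h; exact h.1
  rw [hset]
  have h := sum_shell_le_int U (f := fun j => ((j : ℝ) ^ 6)⁻¹) (fun j => by positivity) N M
  have h1 := sum_Icc_shell_inv_pow_six_le hN M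
  calc _ ≤ _ := h
    _ ≤ 8 * (24 / (N : ℝ) ^ 3) := by gcongr
    _ = 192 / (N : ℝ) ^ 3 := by ring

/-! ### Euclidean versus sup norm -/

/-- `|n|∞² ≤ ∑ⱼ nⱼ²`. [folklore] -/
theorem supNorm_sq_le_nsq (n : Fin 3 → ℤ) :
    ((((univ.sup fun j => (n j).natAbs : ℕ)) : ℝ)) ^ 2 ≤ ∑ j, ((n j : ℤ) : ℝ) ^ 2 := by
  obtain ⟨i, hi⟩ := exists_natAbs_eq_supNorm n
  rw [← hi]
  have h1 : ((((n i).natAbs : ℕ) : ℝ)) ^ 2 = ((n i : ℤ) : ℝ) ^ 2 := by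
    rw [Nat.cast_natAbs, Int.cast_abs, sq_abs]
  rw [h1]
  exact Finset.single_le_sum (f := fun j => ((n j : ℤ) : ℝ) ^ 2) (fun j _ => sq_nonneg _) (mem_univ i)

/-- `∑ⱼ nⱼ² ≤ 3|n|∞²`. [folklore] -/
theorem nsq_le_three_supNorm_sq (n : Fin 3 → ℤ) :
    ∑ j, ((n j : ℤ) : ℝ) ^ 2 ≤ 3 * ((((univ.sup fun j => (n j).natAbs : ℕ)) : ℝ)) ^ 2 := by
  calc ∑ j, ((n j : ℤ) : ℝ) ^ 2 ≤ ∑ _j : Fin 3, ((((univ.sup fun j => (n j).natAbs : ℕ)) : ℝ)) ^ 2 := by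
        refine sum_le_sum fun j _ => ?_
        have h := natAbs_le_supNorm n j
        have h' : |((n j : ℤ) : ℝ)| ≤ (((univ.sup fun j => (n j).natAbs : ℕ)) : ℝ) := by
          rw [← Int.cast_abs, ← Nat.cast_natAbs]; exact_mod_cast h
        calc ((n j : ℤ) : ℝ) ^ 2 = |((n j : ℤ) : ℝ)| ^ 2 := (sq_abs _).symm
          _ ≤ _ := pow_le_pow_left₀ (abs_nonneg _) h' 2
    _ = 3 * ((((univ.sup fun j => (n j).natAbs : ℕ)) : ℝ)) ^ 2 := by simp

end IntLattice

end Literature.MathematicalPhysics.QuantumManyBody.BoseGas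

end
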